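import Summits.AtomisticToContinuum.Crystallization.Theses.DisclinationRation
import Summits.AtomisticToContinuum.Crystallization.Theorems.DisclinationRationHullGlueStubCleanCores
import Summits.AtomisticToContinuum.Crystallization.Theorems.DisclinationRationHullGlueStubHullCompactness
import Summits.AtomisticToContinuum.Crystallization.Theorems.DisclinationRationHullGlueStubSiteGoodOfLimit

/-!
# Crux `HullGlue` of route `DisclinationRation` (item stmt-AtomisticToContinuum-15802) — PROVED

EXACTIFICATION no. 2, inside the hull, for the `{fcc, hcp}`-goodness predicate.  Let `x` be a
family of finite configurations of `ℝ³` (Lennard-Jones ground states in the item; not used), and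
`S` a hull element of `x` (two-way `ε`-matched with translates of `x (φ j)` on every ball,
eventually in `j`) that is `δ`-separated (`δ > 0`), relatively dense and everywhere alphabet-good
(not used).  If the points of `S` that are NOT `1/20`-{fcc,hcp}-good have density zero uniformly
on balls, then some hull element `S₂ ∋ 0` of `x` is `δ`-separated, relatively dense and EVERYWHERE
`1/20`-{fcc,hcp}-good.  The route's inlined goodness clause `GF S y` is, definitionally, the landed
name `Theorems.SiteGood S y` (`HullExactificationCascadeHullGoodEverywhereDefs.lean`).

Proof (`HullGlue_of`), line `birth` of the crux chain — CLEAN CORES → HULL COMPACTNESS →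
CLOSEDNESS OF FIXED-TOLERANCE GOODNESS, the three landed stubs composed exactly as in the registered
skeleton `Cruxes/HullGlue/Lines/birth.lean`:
1. `stub_cleanCores` — defect-free balls (grid/pigeonhole) and relative denseness give recentred
   sets `X n ∋ 0`, `δ`-separated, hull elements of `x`, `R₁`-dense, `SiteGood` on the core `‖z‖ ≤ n`;
2. `stub_hullCompactness` — a subsequence `X (ψ k)` converges locally to a `δ`-separated,
   `(R₁+1)`-dense hull element `S₂ ∋ 0` of `x` (limits of local limits are local limits);
3. `stub_siteGoodOfLimit` — goodness with the CLOSED tolerance `≤ 1/20`, the STRICT cutoff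
   `13/10·d` and the site-dependent scale `d` passes to the local limit (annular gap
   `[19d/20, 21d/20]` vs `13d/10`; compact `O(3)`; finitely many labellings), along `k ≤ ψ k`.

Sources: Radin 1991 §2–3 (ground-state hull); Bellissard–Radin–Shlosman 2010 §2; Baake–Grimm 2013,
Remark 5.6 (local rubber topology).  All steps `[folklore]`; template `hullExactShells_proof`
(item 12092).
-/

noncomputable section

namespace Summit.AtomisticToContinuum.Crystallization.Theorems.DisclinationRationHullGlue

open Filter Topology

/-- **Crux `HullGlue` (route `DisclinationRation`, item stmt-AtomisticToContinuum-15802).**  For a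
family `x` of finite configurations of `ℝ³` and a `δ`-separated, relatively dense hull element `S`
of `x` whose non-`1/20`-{fcc,hcp}-good points have density zero uniformly on balls, some hull
element `S₂ ∋ 0` of `x` is `δ`-separated, relatively dense and everywhere `1/20`-{fcc,hcp}-good.
Composition `stub_siteGoodOfLimit ∘ stub_hullCompactness ∘ stub_cleanCores` (cores, extract, pass
goodness to the limit along `k ≤ ψ k`); the ground-state and alphabet-goodness hypotheses are not
used. [folklore] -/
theorem HullGlue_of : Summit.AtomisticToContinuum.Crystallization.Theses.DisclinationRation.HullGlue := by
  intro x _hx S δ hδ hsep hHL hdense _hGA hdens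
  obtain ⟨X, R₁, hX⟩ := stub_cleanCores x S δ hδ hsep hHL hdense hdens
  obtain ⟨ψ, hψ, S₂, hsep₂, h0₂, hHL₂, hdense₂, hlim⟩ := stub_hullCompactness x X δ R₁ hδ
    (fun n => (hX n).1) (fun n => (hX n).2.1) (fun n => (hX n).2.2.1) (fun n => (hX n).2.2.2.1)
  refine ⟨S₂, hsep₂, h0₂, hHL₂, ⟨R₁ + 1, hdense₂⟩, ?_⟩
  intro y hy
  exact stub_siteGoodOfLimit (fun k => X (ψ k)) S₂ δ R₁ hδ (fun k => (hX (ψ k)).1) hsep₂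
    (fun k => (hX (ψ k)).2.2.2.1) hlim
    (fun k z hz hzk => (hX (ψ k)).2.2.2.2 z hz (hzk.trans (by exact_mod_cast hψ.le_apply))) y hy

end Summit.AtomisticToContinuum.Crystallization.Theorems.DisclinationRationHullGlue

end
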